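import Summits.Parity.BatemanHorn.Theorems.RoughParitySectorsOddSectorShareNonlinearPerSystem

/-!
# Crux `OddSectorShareNonlinear` (stmt-Parity-15628) BY ITSELF: Bateman–Horn for the nonlinear systems
# modulo their parity balance, and their parity balance modulo Bateman–Horn

Lead c2 of the line `registered` (prover-line-stmt-Parity-15628-c2-0, 2026-08-17).  Everything here is
PROVED (no `sorry`, no definition, no new fact), one-liners over the per-system kit
`Exactness.asymptotic_of_balance_of_share` / `share_of_asymptotic_of_balance` /
`balance_of_asymptotic_of_share` (files `…PerSystem.lean`, `…Exactness.lean`):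

* `oddSectorShareNonlinear_iff_asymptotic_of_balance` — modulo the parity balance of the NONLINEAR
  systems only, `OddSectorShareNonlinear ↔ (BatemanHornAsymptotic f` for every Bateman–Horn system
  with a member of degree `≥ 2)`; in particular
  `RoughParityBalance → (OddSectorShareNonlinear ↔ BH|nonlinear)`
  (`oddSectorShareNonlinear_iff_of_roughParityBalance`) — the crux-alone form of c1's
  `oddSectorShares_iff_batemanHorn` (no all-linear sibling involved);
* `oddSectorShareNonlinear_iff_balance_of_asymptotic` — modulo Bateman–Horn for the nonlinear systems,
  `OddSectorShareNonlinear ↔` parity balance of the nonlinear systems; in particular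
  `BatemanHorn → (OddSectorShareNonlinear ↔ P|nonlinear)` (`oddSectorShareNonlinear_iff_of_batemanHorn`):
  even with the summit in hand the crux would still be exactly the sifted parity statement;
* `oddSectorShareNonlinear_of_complement` — minimality for this crux alone: any `X` with
  `P|nonlinear → X → BH|nonlinear` already gives `P|nonlinear → X → OddSectorShareNonlinear`, so no
  line for the crux can register a closing stub that is genuinely weaker than the crux.

Reading (census of the lead lineage c0/c1/c2): every instance of the crux contains an irreducible
member of degree `≥ 2`, for which proving the crux proves "parity balance of the rough values of `f`
⟹ Bateman–Horn for `f`", and not even Bateman–Horn for `f` gives the crux without that parity bit.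
The crux is the route's honest open leaf, to be parked, not re-lined.

References: Bateman–Horn, Math. Comp. 16 (1962) (1)–(2) [BatemanHorn1962]; E. Bombieri, The
asymptotic sieve (1976) [BombieriAsymptoticSieve1976]; K. Ford, On Bombieri's asymptotic sieve
(2005) [Ford2004].
-/

namespace Summit.Parity.BatemanHorn.Cruxes.OddSectorShareNonlinear.Birth

open Filter Finset Polynomial
open scoped Topology
open Literature.NumberTheory.Sieve
open Summit.Parity.BatemanHorn.Theses.RoughParitySectors

/-! ### The crux `OddSectorShareNonlinear` alone -/

/-- **Modulo the parity balance of the NONLINEAR systems, the crux IS Bateman–Horn for the nonlinear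
systems**: if `P_f` holds for every Bateman–Horn system with a member of degree `≥ 2`, then
`OddSectorShareNonlinear ↔ ∀` such `f`, `BatemanHornAsymptotic f`. [folklore] -/
theorem oddSectorShareNonlinear_iff_asymptotic_of_balance
    (hP : ∀ (k : ℕ) (f : Fin k → ℤ[X]), IsBatemanHornSystem f → (∃ i, 2 ≤ (f i).natDegree) →
      ∀ δ : ℝ, 0 < δ → ∃ U₀ : ℝ, ∀ U : ℝ, U₀ ≤ U → ∀ᶠ x : ℕ in Filter.atTop, |(2 : ℝ) ^ k *
      (((((Finset.Icc 1 x).filter (fun n : ℕ => ∀ i, 0 < (f i).eval (n : ℤ) ∧ ∀ p ∈ Finset.range ⌈(x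
      : ℝ) ^ (((f i).natDegree : ℝ) / U)⌉₊, p.Prime → ¬ ((p : ℤ) ∣ (f i).eval (n : ℤ)))).filter (fun
      n : ℕ => ∀ i, Odd (ArithmeticFunction.cardFactors (((f i).eval (n : ℤ)).toNat)))).card : ℕ) :
      ℝ) - ((((Finset.Icc 1 x).filter (fun n : ℕ => ∀ i, 0 < (f i).eval (n : ℤ) ∧ ∀ p ∈ Finset.range
      ⌈(x : ℝ) ^ (((f i).natDegree : ℝ) / U)⌉₊, p.Prime → ¬ ((p : ℤ) ∣ (f i).eval (n : ℤ)))).card :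
      ℕ) : ℝ)| ≤ δ * ((((Finset.Icc 1 x).filter (fun n : ℕ => ∀ i, 0 < (f i).eval (n : ℤ) ∧ ∀ p ∈
      Finset.range ⌈(x : ℝ) ^ (((f i).natDegree : ℝ) / U)⌉₊, p.Prime → ¬ ((p : ℤ) ∣ (f i).eval (n :
      ℤ)))).card : ℕ) : ℝ)) :
    OddSectorShareNonlinear ↔
      ∀ (k : ℕ) (f : Fin k → ℤ[X]), IsBatemanHornSystem f → (∃ i, 2 ≤ (f i).natDegree) →
        BatemanHornAsymptotic f :=
  ⟨fun hN k f hf h => Exactness.asymptotic_of_balance_of_share hf (hP k f hf h) (hN k f hf h),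
    fun hBH k f hf h => Exactness.share_of_asymptotic_of_balance hf (hBH k f hf h) (hP k f hf h)⟩

/-- **Modulo Bateman–Horn for the NONLINEAR systems, the crux IS their parity balance**: if
`BatemanHornAsymptotic f` holds for every Bateman–Horn system with a member of degree `≥ 2`, then
`OddSectorShareNonlinear ↔ ∀` such `f`, `P_f`. [folklore] -/
theorem oddSectorShareNonlinear_iff_balance_of_asymptotic
    (hBH : ∀ (k : ℕ) (f : Fin k → ℤ[X]), IsBatemanHornSystem f → (∃ i, 2 ≤ (f i).natDegree) →
      BatemanHornAsymptotic f) :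
    OddSectorShareNonlinear ↔
      ∀ (k : ℕ) (f : Fin k → ℤ[X]), IsBatemanHornSystem f → (∃ i, 2 ≤ (f i).natDegree) →
        ∀ δ : ℝ, 0 < δ → ∃ U₀ : ℝ, ∀ U : ℝ, U₀ ≤ U → ∀ᶠ x : ℕ in Filter.atTop, |(2 : ℝ) ^ k *
      (((((Finset.Icc 1 x).filter (fun n : ℕ => ∀ i, 0 < (f i).eval (n : ℤ) ∧ ∀ p ∈ Finset.range ⌈(x
      : ℝ) ^ (((f i).natDegree : ℝ) / U)⌉₊, p.Prime → ¬ ((p : ℤ) ∣ (f i).eval (n : ℤ)))).filter (fun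
      n : ℕ => ∀ i, Odd (ArithmeticFunction.cardFactors (((f i).eval (n : ℤ)).toNat)))).card : ℕ) :
      ℝ) - ((((Finset.Icc 1 x).filter (fun n : ℕ => ∀ i, 0 < (f i).eval (n : ℤ) ∧ ∀ p ∈ Finset.range
      ⌈(x : ℝ) ^ (((f i).natDegree : ℝ) / U)⌉₊, p.Prime → ¬ ((p : ℤ) ∣ (f i).eval (n : ℤ)))).card :
      ℕ) : ℝ)| ≤ δ * ((((Finset.Icc 1 x).filter (fun n : ℕ => ∀ i, 0 < (f i).eval (n : ℤ) ∧ ∀ p ∈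
      Finset.range ⌈(x : ℝ) ^ (((f i).natDegree : ℝ) / U)⌉₊, p.Prime → ¬ ((p : ℤ) ∣ (f i).eval (n :
      ℤ)))).card : ℕ) : ℝ) :=
  ⟨fun hN k f hf h => Exactness.balance_of_asymptotic_of_share hf (hBH k f hf h) (hN k f hf h),
    fun hP k f hf h => Exactness.share_of_asymptotic_of_balance hf (hBH k f hf h) (hP k f hf h)⟩

/-- **`RoughParityBalance → (OddSectorShareNonlinear ↔ Bateman–Horn for the nonlinear systems)`** —
the crux-by-itself form of c1's `oddSectorShares_iff_batemanHorn` (no all-linear sibling involved).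
[folklore] -/
theorem oddSectorShareNonlinear_iff_of_roughParityBalance (hP : RoughParityBalance) :
    OddSectorShareNonlinear ↔
      ∀ (k : ℕ) (f : Fin k → ℤ[X]), IsBatemanHornSystem f → (∃ i, 2 ≤ (f i).natDegree) →
        BatemanHornAsymptotic f :=
  oddSectorShareNonlinear_iff_asymptotic_of_balance fun k f hf _ => hP k f hf

/-- **`BatemanHorn → (OddSectorShareNonlinear ↔ parity balance of the nonlinear systems)`**: even
WITH the summit in hand the crux would still be exactly the (sifted, `u → ∞`) parity statement along
every system with a nonlinear member. [folklore] -/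
theorem oddSectorShareNonlinear_iff_of_batemanHorn (hBH : _root_.BatemanHorn) :
    OddSectorShareNonlinear ↔
      ∀ (k : ℕ) (f : Fin k → ℤ[X]), IsBatemanHornSystem f → (∃ i, 2 ≤ (f i).natDegree) →
        ∀ δ : ℝ, 0 < δ → ∃ U₀ : ℝ, ∀ U : ℝ, U₀ ≤ U → ∀ᶠ x : ℕ in Filter.atTop, |(2 : ℝ) ^ k *
      (((((Finset.Icc 1 x).filter (fun n : ℕ => ∀ i, 0 < (f i).eval (n : ℤ) ∧ ∀ p ∈ Finset.range ⌈(x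
      : ℝ) ^ (((f i).natDegree : ℝ) / U)⌉₊, p.Prime → ¬ ((p : ℤ) ∣ (f i).eval (n : ℤ)))).filter (fun
      n : ℕ => ∀ i, Odd (ArithmeticFunction.cardFactors (((f i).eval (n : ℤ)).toNat)))).card : ℕ) :
      ℝ) - ((((Finset.Icc 1 x).filter (fun n : ℕ => ∀ i, 0 < (f i).eval (n : ℤ) ∧ ∀ p ∈ Finset.range
      ⌈(x : ℝ) ^ (((f i).natDegree : ℝ) / U)⌉₊, p.Prime → ¬ ((p : ℤ) ∣ (f i).eval (n : ℤ)))).card :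
      ℕ) : ℝ)| ≤ δ * ((((Finset.Icc 1 x).filter (fun n : ℕ => ∀ i, 0 < (f i).eval (n : ℤ) ∧ ∀ p ∈
      Finset.range ⌈(x : ℝ) ^ (((f i).natDegree : ℝ) / U)⌉₊, p.Prime → ¬ ((p : ℤ) ∣ (f i).eval (n :
      ℤ)))).card : ℕ) : ℝ) :=
  oddSectorShareNonlinear_iff_balance_of_asymptotic fun k f hf _ => hBH k f hf

/-- **Minimality of the crux by itself.**  Any statement `X` that yields Bateman–Horn for the
nonlinear systems from their parity balance already implies `OddSectorShareNonlinear` given that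
balance: modulo `P|nonlinear` the crux is the WEAKEST closing complement, so no line for it can
register a closing stub that is genuinely weaker. [folklore] -/
theorem oddSectorShareNonlinear_of_complement {X : Prop}
    (hX : (∀ (k : ℕ) (f : Fin k → ℤ[X]), IsBatemanHornSystem f → (∃ i, 2 ≤ (f i).natDegree) →
      ∀ δ : ℝ, 0 < δ → ∃ U₀ : ℝ, ∀ U : ℝ, U₀ ≤ U → ∀ᶠ x : ℕ in Filter.atTop, |(2 : ℝ) ^ k *
      (((((Finset.Icc 1 x).filter (fun n : ℕ => ∀ i, 0 < (f i).eval (n : ℤ) ∧ ∀ p ∈ Finset.range ⌈(x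
      : ℝ) ^ (((f i).natDegree : ℝ) / U)⌉₊, p.Prime → ¬ ((p : ℤ) ∣ (f i).eval (n : ℤ)))).filter (fun
      n : ℕ => ∀ i, Odd (ArithmeticFunction.cardFactors (((f i).eval (n : ℤ)).toNat)))).card : ℕ) :
      ℝ) - ((((Finset.Icc 1 x).filter (fun n : ℕ => ∀ i, 0 < (f i).eval (n : ℤ) ∧ ∀ p ∈ Finset.range
      ⌈(x : ℝ) ^ (((f i).natDegree : ℝ) / U)⌉₊, p.Prime → ¬ ((p : ℤ) ∣ (f i).eval (n : ℤ)))).card :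
      ℕ) : ℝ)| ≤ δ * ((((Finset.Icc 1 x).filter (fun n : ℕ => ∀ i, 0 < (f i).eval (n : ℤ) ∧ ∀ p ∈
      Finset.range ⌈(x : ℝ) ^ (((f i).natDegree : ℝ) / U)⌉₊, p.Prime → ¬ ((p : ℤ) ∣ (f i).eval (n :
      ℤ)))).card : ℕ) : ℝ)) → X →
      ∀ (k : ℕ) (f : Fin k → ℤ[X]), IsBatemanHornSystem f → (∃ i, 2 ≤ (f i).natDegree) →
        BatemanHornAsymptotic f)
    (hP : ∀ (k : ℕ) (f : Fin k → ℤ[X]), IsBatemanHornSystem f → (∃ i, 2 ≤ (f i).natDegree) →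
      ∀ δ : ℝ, 0 < δ → ∃ U₀ : ℝ, ∀ U : ℝ, U₀ ≤ U → ∀ᶠ x : ℕ in Filter.atTop, |(2 : ℝ) ^ k *
      (((((Finset.Icc 1 x).filter (fun n : ℕ => ∀ i, 0 < (f i).eval (n : ℤ) ∧ ∀ p ∈ Finset.range ⌈(x
      : ℝ) ^ (((f i).natDegree : ℝ) / U)⌉₊, p.Prime → ¬ ((p : ℤ) ∣ (f i).eval (n : ℤ)))).filter (fun
      n : ℕ => ∀ i, Odd (ArithmeticFunction.cardFactors (((f i).eval (n : ℤ)).toNat)))).card : ℕ) :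
      ℝ) - ((((Finset.Icc 1 x).filter (fun n : ℕ => ∀ i, 0 < (f i).eval (n : ℤ) ∧ ∀ p ∈ Finset.range
      ⌈(x : ℝ) ^ (((f i).natDegree : ℝ) / U)⌉₊, p.Prime → ¬ ((p : ℤ) ∣ (f i).eval (n : ℤ)))).card :
      ℕ) : ℝ)| ≤ δ * ((((Finset.Icc 1 x).filter (fun n : ℕ => ∀ i, 0 < (f i).eval (n : ℤ) ∧ ∀ p ∈
      Finset.range ⌈(x : ℝ) ^ (((f i).natDegree : ℝ) / U)⌉₊, p.Prime → ¬ ((p : ℤ) ∣ (f i).eval (n :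
      ℤ)))).card : ℕ) : ℝ))
    (x : X) : OddSectorShareNonlinear :=
  (oddSectorShareNonlinear_iff_asymptotic_of_balance hP).2 (hX hP x)

end Summit.Parity.BatemanHorn.Cruxes.OddSectorShareNonlinear.Birth
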